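import Summits.QuantumFields.BalabanUV.Beta.VertexReflectionContact
import Summits.QuantumFields.BalabanUV.Beta.SpineRootedStepN
import Summits.QuantumFields.BalabanUV.Beta.TameKernelCalculus

/-!
# The reflection law of the level-1 rooted third jet `e3NAtOf … 1`, with its contact EXPLICIT

HONEST FRAMING (pub-balaban β cell). Discharging `BetaPertH` makes Balaban's UV stability UNCONDITIONAL — a real
constructive-QFT result; it is NOT the continuum limit and NOT the Clay problem. This module is NOT (D1), NOT `BetaPertH`.
HONEST DEPENDENCY: continuum YM on `T⁴` ⇐ `BetaPertH` ∧ nine spine estimates (0/9 proved); `BetaPertH` ⇐ (D1) ∧ (D4) ∧ CAP+tail.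

WHAT IS PROVED ([folklore] kernel algebra; no analytic number is produced). Lineage an3, socket (L3) = hypothesis `hE3ff` of
`SpineRooted.SstepNAt_bref_of_e3Law` (`Beta/StepReflection`). Write `ρ := ctr (d+1) Lc`, `ε := reflSign α κ′`,
`V κ′ u := vertexOf (N := Lc) (S0NAt d Lc ρ cE cVH cΛ) κ′ u` and, for the reflection of axis `α`,

  `W α κ′ u := conjV (bhKAt d ρ Lc) ((cVH / Lc^{d+1}) • diagK (p c ↦ Σ_κ Σ'_t colH KInv Lc κ′ u κ t · ctGen d α Lc κ t p c))`
  `𝒞 α κ′ u := −mmRead Lc (KInv ∘ W α κ′ u ∘ KInv)`                                    (the LEVEL-1 THIRD-JET CONTACT).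

* §1 `refK` is additive, homogeneous and, for the leg map `Φ N α`, an involution (`refK_Φ_refK_Φ`); hence a reflection law
  `V′ = ε • refK Φ (V + W)` determines its contact: `W = ε • refK Φ V′ − V` (`contact_eq_of_law`).
* §2 LOCALITY IS REFLECTION-STABLE: `l1 (x − sref α p) ≤ l1 ((Φ N α).r a x − p) + 2N` (`l1_sub_sref_le`), so a kernel
  bi-localised at `(p, q)` reflects to one bi-localised at `(sref α p, sref α q)` with the same rate (`biLoc_refK_Φ`, `loc_refK_Φ`).
* §3 THE GENERIC LAW (`neg_mmRead_sandwich_vertexOf_S0NAt_bref`): for ANY spread (`TameKernelCalculus.Spr`) sandwich kernel `K`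
  with `refK (Φ Lc α) K = K`, under the normalisation `2·cVH = −cE·Lc^{d+1}` and `Odd Lc`,
  `−mmRead Lc (K ∘ V κ′ (bref α κ′ u) ∘ K) = ε • refK (Φ Lc α) (−mmRead Lc (K ∘ V κ′ u ∘ K) + −mmRead Lc (K ∘ W α κ′ u ∘ K))`
  — the vertex law `VertexReflectionContact.vertexOf_S0NAt_bref'` pushed through `VertexReflectionContact.neg_mmRead_sandwich_bref`,
  the four slice summabilities discharged by the tame calculus (`K` spread; `V κ′ u` localised by `vertexFamily_vertexOf'` and
  `SpineRooted.locStencil_S0NAt`; `W` localised because it IS `ε • refK Φ (V κ′ (bref u)) − V κ′ u`, §1–§2).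
* §4 THE INSTANCE `K = KInv` (`decays_KInv`, `refK_KInv`): `e3NAtOf_one` identifies `e3NAtOf … 1 κ′ u = −mmRead Lc (KInv ∘ V κ′ u ∘ KInv)`
  (transport `Lc ^ 1 = Lc` through the `NeZero` instance), `e3NAtOf_one_bref` is the kernel-level law
  `e3NAtOf … 1 κ′ (bref α κ′ u) = ε • refK (Φ Lc α) (e3NAtOf … 1 κ′ u + 𝒞 α κ′ u)`, `e3NAtOf_one_bref_inl_inl` its field–field
  entries in the exact spelling of `hE3ff`, and `e3Law_ff_iff` the REDUCTION OF THE SOCKET TO A CONTACT EVALUATION: for any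
  candidate kernel `C′`, the `hE3ff`-shaped law with `C′` in the contact slot holds at `(α, κ′, u)` iff `𝒞 α κ′ u` and `C′` have
  the same field–field block (`e3Law_one_iff_contact`: the literal level-1 `hE3ff` ⟺ the diagonal-contact identity for `𝒞`).
  In particular `hE3ff` as typed (contact slot `c · conjV 𝕄 (diagK (ctGen d α Lc κ′ u))`) is
  EQUIVALENT to `𝒞_ff = c · (conjV 𝕄 (diagK ctGen))_ff`; an exact-rational toy (an3-g29, journal RESULT l.6419, re-executed by
  REFEREE #2 l.6621) indicates this identity FAILS for the raw straight resolvent at `d = 1, Lc = 3` (the true contact is not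
  diagonal), so the evaluation / dressing of `𝒞` is the row owner's (an2) repair — this module asserts nothing about it.

All statements are equalities of absolutely convergent lattice sums or elementary estimates; no proof placeholders, no new definitions.
-/

noncomputable section

open Finset
open scoped BigOperators
open Literature.MathematicalPhysics.QuantumFieldTheory
open Literature.MathematicalPhysics.QuantumFieldTheory.Balaban1983to89
open Literature.MathematicalPhysics.QuantumFieldTheory.Balaban1983to89.Beta
open B12Sec2to5 (l1 l1_nonneg)
open ExpKernelCalculus (MKer comp Decays BiLoc VertexFamily)
open PolarizationSign (reflSign)
open KernelReflection (LegMap refK refK_apply)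
open ResolventReflection (sref sref_apply bref bref_bref bref_apply mref mref_mref Φ Φ_r_inl Φ_r_inr Φ_s_inl Φ_s_inr
  reflSign_mul_self refK_KInv)
open OneStepResolventKernel (Fib KInv vertexOf LocStencil decays_KInv vertexFamily_vertexOf')
open OneStepKernelFamily (colH)
open BalabanStepJetsSucc (mmRead)
open AffineAveraging (box toSite)
open AveragingContoursRooted (ctr ctrOff ctrOff_mem_box)
open Summit.QuantumFields.BalabanUV.Beta.ChartConjugation (conjV)
open Summit.QuantumFields.BalabanUV.Beta.BorderedHessian (bhKAt ctGen diagK)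
open Summit.QuantumFields.BalabanUV.Beta.SpineRooted (S0NAt ScNAt locStencil_S0NAt e3NAtOf)
open Summit.QuantumFields.BalabanUV.Beta.TameKernelCalculus (Spr Loc Tame slice_tame)
open Summit.QuantumFields.BalabanUV.Beta.VertexReflectionContact (neg_mmRead_sandwich_bref vertexOf_S0NAt_bref')

namespace Summit.QuantumFields.BalabanUV.Beta.E3LevelOneReflection

variable {d N : ℕ}

/-! ## §1 `refK` algebra: additivity, homogeneity, involution; the contact of a law -/

section RefK

variable {D : ℕ} {F : Type*}

/-- [folklore] Leg relabelling is additive. -/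
theorem refK_add (Ψ : LegMap D F) (X Y : MKer D F) : refK Ψ (X + Y) = refK Ψ X + refK Ψ Y := by
  funext x z a b; simp only [refK_apply, Pi.add_apply]; ring

/-- [folklore] Leg relabelling is homogeneous. -/
theorem refK_smul (Ψ : LegMap D F) (c : ℝ) (X : MKer D F) : refK Ψ (c • X) = c • refK Ψ X := by
  funext x z a b; simp only [refK_apply, Pi.smul_apply, smul_eq_mul]; ring

/-- [folklore] Leg relabelling commutes with subtraction. -/
theorem refK_sub (Ψ : LegMap D F) (X Y : MKer D F) : refK Ψ (X - Y) = refK Ψ X - refK Ψ Y := by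
  funext x z a b; simp only [refK_apply, Pi.sub_apply]; ring

end RefK

/-- [folklore] Each leg map of `Φ N α` is an involution of the fine lattice. -/
theorem Φ_r_r (α : Fin (d + 1)) (a : Fib d) (x : Fin (d + 1) → ℤ) : (Φ (d := d) N α).r a ((Φ (d := d) N α).r a x) = x := by
  cases a with
  | inl κ => rw [Φ_r_inl, Φ_r_inl, bref_bref]
  | inr κ => rw [Φ_r_inr, Φ_r_inr, mref_mref]

/-- [folklore] **`refK (Φ N α)` IS AN INVOLUTION.** -/
theorem refK_Φ_refK_Φ (α : Fin (d + 1)) (X : MKer (d + 1) (Fib d)) : refK (Φ (d := d) N α) (refK (Φ (d := d) N α) X) = X := by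
  funext x z a b
  have hs := (Φ (d := d) N α).s_mul_s
  simp only [refK_apply, Φ_r_r]
  calc (Φ (d := d) N α).s a * (Φ (d := d) N α).s b *
        ((Φ (d := d) N α).s a * (Φ (d := d) N α).s b * X x z a b)
        = ((Φ (d := d) N α).s a * (Φ (d := d) N α).s a) * ((Φ (d := d) N α).s b * (Φ (d := d) N α).s b) * X x z a b := by
          ring
    _ = X x z a b := by rw [hs, hs, one_mul, one_mul]

/-- [folklore] The signs of `Φ N α` have absolute value one. -/
theorem abs_Φ_s (α : Fin (d + 1)) (a : Fib d) : |(Φ (d := d) N α).s a| = 1 := by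
  rcases mul_self_eq_one_iff.mp ((Φ (d := d) N α).s_mul_s a) with h | h <;> simp [h]

/-- [folklore] **A REFLECTION LAW DETERMINES ITS CONTACT**: from `V′ = ε • refK (Φ N α) (V + W)` (`ε = reflSign α μ`) follows
`W = ε • refK (Φ N α) V′ − V`. -/
theorem contact_eq_of_law {α μ : Fin (d + 1)} {V V' W : MKer (d + 1) (Fib d)}
    (h : V' = reflSign α μ • refK (Φ (d := d) N α) (V + W)) : W = reflSign α μ • refK (Φ (d := d) N α) V' - V := by
  rw [h, refK_smul, refK_Φ_refK_Φ, smul_smul, reflSign_mul_self, one_smul, add_sub_cancel_left]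

/-! ## §2 Locality is reflection-stable -/

/-- Elementary: `u = −v − c` with `0 ≤ c ≤ B` gives `|u| ≤ |v| + B`. -/
private theorem abs_le_abs_add_of_eq {u v c B : ℝ} (h : u = -v - c) (hc0 : 0 ≤ c) (hcB : c ≤ B) : |u| ≤ |v| + B := by
  subst h
  rw [abs_le]
  constructor <;> linarith [le_abs_self v, neg_le_abs v]

/-- [folklore] **THE `ℓ¹` DISTANCE TO A REFLECTED CENTRE**: for every leg type `a`, `l1 (x − sref α p) ≤ l1 ((Φ N α).r a x − p) + 2N`
(`N ≥ 1`; the leg maps `bref α κ` / `mref N α κ` differ from the site reflection `sref α` by a shift of `ℓ¹`-size `≤ 2N − 1`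
along the axis `α`, and `l1 (r x − p) = l1 (x − r p)` for each of them). -/
theorem l1_sub_sref_le (hN : 1 ≤ N) (α : Fin (d + 1)) (a : Fib d) (x p : Fin (d + 1) → ℤ) :
    l1 (x - sref α p) ≤ l1 ((Φ (d := d) N α).r a x - p) + 2 * N := by
  classical
  have hN' : (1 : ℝ) ≤ N := by exact_mod_cast hN
  have key : ∀ i, |(((x - sref α p) i : ℤ) : ℝ)| ≤
      |((((Φ (d := d) N α).r a x - p) i : ℤ) : ℝ)| + if i = α then 2 * (N : ℝ) else 0 := by
    intro i
    by_cases hi : i = α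
    · subst hi
      simp only [if_true, Pi.sub_apply, sref_apply]
      cases a with
      | inl κ =>
        rw [Φ_r_inl, bref_apply]
        simp only [if_true]
        by_cases hκ : κ = i
        · simp only [hκ, if_true]; push_cast
          exact abs_le_abs_add_of_eq (c := 1) (by ring) (by norm_num) (by linarith)
        · simp only [hκ, if_false]; push_cast
          exact abs_le_abs_add_of_eq (c := 0) (by ring) le_rfl (by linarith)
      | inr κ =>
        rw [Φ_r_inr]
        simp only [mref, if_true]
        by_cases hκ : κ = i
        · simp only [hκ, if_true]; push_cast
          exact abs_le_abs_add_of_eq (c := 2 * (N : ℝ) - 1) (by ring) (by linarith) (by linarith)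
        · simp only [hκ, if_false]; push_cast
          exact abs_le_abs_add_of_eq (c := (N : ℝ) - 1) (by ring) (by linarith) (by linarith)
    · simp only [hi, if_false, add_zero, Pi.sub_apply, sref_apply]
      cases a with
      | inl κ => rw [Φ_r_inl, bref_apply]; simp only [hi, if_false]; exact le_rfl
      | inr κ => rw [Φ_r_inr]; simp only [mref, hi, if_false]; exact le_rfl
  calc l1 (x - sref α p) = ∑ i, |(((x - sref α p) i : ℤ) : ℝ)| := rfl
    _ ≤ ∑ i, (|((((Φ (d := d) N α).r a x - p) i : ℤ) : ℝ)| + if i = α then 2 * (N : ℝ) else 0) :=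
        Finset.sum_le_sum fun i _ => key i
    _ = l1 ((Φ (d := d) N α).r a x - p) + 2 * N := by
        rw [Finset.sum_add_distrib, Finset.sum_ite_eq' Finset.univ α]; simp [l1]

/-- [folklore] **BI-LOCALITY IS REFLECTION-STABLE**: a kernel bi-localised at `(p, q)` with rate `δ ≥ 0` reflects under `Φ N α`
(`N ≥ 1`) to a kernel bi-localised at `(sref α p, sref α q)` with the same rate and constant `|C|·e^{4Nδ}`. -/
theorem biLoc_refK_Φ (hN : 1 ≤ N) {X : MKer (d + 1) (Fib d)} {p q : Fin (d + 1) → ℤ} {C δ : ℝ} (hX : BiLoc X p q C δ)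
    (hδ : 0 ≤ δ) (α : Fin (d + 1)) :
    BiLoc (refK (Φ (d := d) N α) X) (sref α p) (sref α q) (|C| * Real.exp (δ * (4 * N))) δ := by
  intro x z a b
  rw [refK_apply, abs_mul, abs_mul, abs_Φ_s, abs_Φ_s, one_mul, one_mul]
  have h1 := l1_sub_sref_le (d := d) hN α a x p
  have h2 := l1_sub_sref_le (d := d) hN α b z q
  calc |X ((Φ (d := d) N α).r a x) ((Φ (d := d) N α).r b z) a b|
      ≤ C * Real.exp (-δ * (l1 ((Φ (d := d) N α).r a x - p) + l1 ((Φ (d := d) N α).r b z - q))) := hX _ _ a b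
    _ ≤ |C| * Real.exp (-δ * (l1 ((Φ (d := d) N α).r a x - p) + l1 ((Φ (d := d) N α).r b z - q))) :=
        mul_le_mul_of_nonneg_right (le_abs_self C) (Real.exp_pos _).le
    _ ≤ |C| * Real.exp (δ * (4 * N) + -δ * (l1 (x - sref α p) + l1 (z - sref α q))) :=
        mul_le_mul_of_nonneg_left (Real.exp_le_exp.mpr (by nlinarith)) (abs_nonneg C)
    _ = |C| * Real.exp (δ * (4 * N)) * Real.exp (-δ * (l1 (x - sref α p) + l1 (z - sref α q))) := by
        rw [Real.exp_add, mul_assoc]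

/-- [folklore] **LOCALISED KERNELS REFLECT TO LOCALISED KERNELS** (`TameKernelCalculus.Loc`). -/
theorem loc_refK_Φ (hN : 1 ≤ N) (α : Fin (d + 1)) {X : MKer (d + 1) (Fib d)} (hX : Loc X) : Loc (refK (Φ (d := d) N α) X) := by
  obtain ⟨p, q, C, δ, hδ, h⟩ := hX
  exact ⟨sref α p, sref α q, _, δ, hδ, biLoc_refK_Φ hN h hδ.le α⟩

/-! ## §3 The generic law: any spread, reflection-invariant sandwich kernel -/

section Law

variable {Lc : ℕ} [NeZero Lc]

/-- [folklore] The chain-rule vertex of the rooted step-0 stencil at the centre root is localised (`Loc`), at every bond. -/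
theorem loc_vertexOf_S0NAt (hLc : 1 ≤ Lc) (cE cVH cΛ : ℝ) (μ : Fin (d + 1)) (y : Fin (d + 1) → ℤ) :
    Loc (vertexOf (N := Lc) (S0NAt d Lc (ctr (d + 1) Lc) cE cVH cΛ) μ y) := by
  obtain ⟨Cs, δ, hδ, hS⟩ := locStencil_S0NAt (d := d) (Lc := Lc) hLc (ctrOff_mem_box hLc) cE cVH cΛ
  obtain ⟨Cv, δv, hδv, hV⟩ := vertexFamily_vertexOf' (N := Lc) hS hδ
  exact ⟨_, _, Cv, δv, hδv, hV μ y⟩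

/-- [folklore] **THE LEVEL-1 CONTACT VERTEX IS LOCALISED**: it is `ε • refK Φ (V μ (bref y)) − V μ y` (`contact_eq_of_law` applied
to `vertexOf_S0NAt_bref'`), a difference of reflected / plain localised vertices. -/
theorem loc_contact (hLc : Odd Lc) {cE cVH : ℝ} (cΛ : ℝ) (hn : 2 * cVH = -(cE * (Lc : ℝ) ^ (d + 1))) (α μ : Fin (d + 1))
    (y : Fin (d + 1) → ℤ) :
    Loc (conjV (bhKAt d (ctr (d + 1) Lc) Lc) ((cVH / (Lc : ℝ) ^ (d + 1)) •
      diagK (fun p c => ∑ κ, ∑' u, colH (KInv (N := Lc)) Lc μ y κ u * ctGen d α Lc κ u p c))) := by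
  have hLc1 : 1 ≤ Lc := hLc.pos
  rw [contact_eq_of_law (vertexOf_S0NAt_bref' (d := d) hLc cΛ hn α μ y)]
  exact ((loc_refK_Φ hLc1 α (loc_vertexOf_S0NAt hLc1 cE cVH cΛ μ _)).smul _).sub (loc_vertexOf_S0NAt hLc1 cE cVH cΛ μ y)

/-- [folklore] **THE REFLECTION LAW OF THE SANDWICHED STEP-0 VERTEX, CONTACT EXPLICIT.**  For any spread sandwich kernel `K`
invariant under `refK (Φ Lc α)`, under `2·cVH = −cE·Lc^{d+1}` and `Odd Lc`:
`−mmRead Lc (K ∘ V μ (bref α μ y) ∘ K) = ε • refK (Φ Lc α) (−mmRead Lc (K ∘ V μ y ∘ K) + −mmRead Lc (K ∘ W α μ y ∘ K))`. -/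
theorem neg_mmRead_sandwich_vertexOf_S0NAt_bref (hLc : Odd Lc) {cE cVH : ℝ} (cΛ : ℝ)
    (hn : 2 * cVH = -(cE * (Lc : ℝ) ^ (d + 1))) {K : MKer (d + 1) (Fib d)} (hKs : Spr K) {α : Fin (d + 1)}
    (hKr : refK (Φ (d := d) Lc α) K = K) (μ : Fin (d + 1)) (y : Fin (d + 1) → ℤ) :
    -mmRead Lc (comp (comp K (vertexOf (N := Lc) (S0NAt d Lc (ctr (d + 1) Lc) cE cVH cΛ) μ (bref α μ y))) K) =
      reflSign α μ • refK (Φ (d := d) Lc α)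
        (-mmRead Lc (comp (comp K (vertexOf (N := Lc) (S0NAt d Lc (ctr (d + 1) Lc) cE cVH cΛ) μ y)) K) +
          -mmRead Lc (comp (comp K (conjV (bhKAt d (ctr (d + 1) Lc) Lc) ((cVH / (Lc : ℝ) ^ (d + 1)) •
            diagK (fun p c => ∑ κ, ∑' u, colH (KInv (N := Lc)) Lc μ y κ u * ctGen d α Lc κ u p c)))) K)) := by
  have hLc1 : 1 ≤ Lc := hLc.pos
  have hKt : Tame K := hKs.tame
  have hVl : ∀ y', Loc (vertexOf (N := Lc) (S0NAt d Lc (ctr (d + 1) Lc) cE cVH cΛ) μ y') :=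
    fun y' => loc_vertexOf_S0NAt hLc1 cE cVH cΛ μ y'
  have hWl := loc_contact (d := d) hLc cΛ hn α μ y
  exact neg_mmRead_sandwich_bref (M := Lc) (N' := Lc)
    (V := fun μ' y' => vertexOf (N := Lc) (S0NAt d Lc (ctr (d + 1) Lc) cE cVH cΛ) μ' y')
    (W := fun μ' y' => conjV (bhKAt d (ctr (d + 1) Lc) Lc) ((cVH / (Lc : ℝ) ^ (d + 1)) •
      diagK (fun p c => ∑ κ, ∑' u, colH (KInv (N := Lc)) Lc μ' y' κ u * ctGen d α Lc κ u p c)))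
    hKr (vertexOf_S0NAt_bref' (d := d) hLc cΛ hn α μ y)
    (fun x z a f b => slice_tame hKt (hVl y).tame x z a f b) (fun x z a f b => slice_tame hKt hWl.tame x z a f b)
    (fun x z a f b => slice_tame (hKs.comp_loc (hVl y)).tame hKt x z a f b)
    (fun x z a f b => slice_tame (hKs.comp_loc hWl).tame hKt x z a f b)

end Law

/-! ## §4 The instance `K = KInv`: the level-1 third jet `e3NAtOf … 1` -/

section Instance

variable {Lc : ℕ} [NeZero Lc]

/-- [folklore] The one-step resolvent is spread. -/
theorem spr_KInv : Spr (KInv (N := Lc) (d := d)) := by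
  obtain ⟨δ, C, hδ, -, h⟩ := decays_KInv (N := Lc) (d := d)
  exact ⟨C, δ, hδ, h⟩

/-- [folklore] **THE LEVEL-1 THIRD JET, UNFOLDED**: `e3NAtOf … 1 κ′ u = −mmRead Lc (KInv ∘ vertexOf (N := Lc) S0NAt κ′ u ∘ KInv)`
(`Lc ^ 1 = Lc` transported through the `NeZero` instance; `ScNAt … 0 = S0NAt …`). -/
theorem e3NAtOf_one (ρ : Fin (d + 1) → ℤ) (cE cVH cΛ : ℝ) (κ' : Fin (d + 1)) (u : Fin (d + 1) → ℤ) :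
    e3NAtOf d Lc ρ cE cVH cΛ 1 κ' u =
      -mmRead Lc (comp (comp (KInv (N := Lc)) (vertexOf (N := Lc) (S0NAt d Lc ρ cE cVH cΛ) κ' u)) (KInv (N := Lc))) := by
  have key : ∀ (M : ℕ) [NeZero M], M = Lc →
      (fun x' z' a b => -(mmRead M (comp (comp (KInv (N := M)) (vertexOf (N := M) (S0NAt d Lc ρ cE cVH cΛ) κ' u))
        (KInv (N := M))) x' z' a b)) =
      -mmRead Lc (comp (comp (KInv (N := Lc)) (vertexOf (N := Lc) (S0NAt d Lc ρ cE cVH cΛ) κ' u)) (KInv (N := Lc))) := by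
    intro M _ hM; subst hM; rfl
  exact key (Lc ^ 1) (pow_one Lc)

/-- [folklore] **THE REFLECTION LAW OF THE LEVEL-1 THIRD JET, CONTACT EXPLICIT** (kernel level):
`e3NAtOf … 1 κ′ (bref α κ′ u) = ε • refK (Φ Lc α) (e3NAtOf … 1 κ′ u + 𝒞 α κ′ u)`, `𝒞 α κ′ u = −mmRead Lc (KInv ∘ W α κ′ u ∘ KInv)`. -/
theorem e3NAtOf_one_bref (hLc : Odd Lc) {cE cVH : ℝ} (cΛ : ℝ) (hn : 2 * cVH = -(cE * (Lc : ℝ) ^ (d + 1)))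
    (α κ' : Fin (d + 1)) (u : Fin (d + 1) → ℤ) :
    e3NAtOf d Lc (ctr (d + 1) Lc) cE cVH cΛ 1 κ' (bref α κ' u) =
      reflSign α κ' • refK (Φ (d := d) Lc α) (e3NAtOf d Lc (ctr (d + 1) Lc) cE cVH cΛ 1 κ' u +
        -mmRead Lc (comp (comp (KInv (N := Lc)) (conjV (bhKAt d (ctr (d + 1) Lc) Lc) ((cVH / (Lc : ℝ) ^ (d + 1)) •
          diagK (fun p c => ∑ κ, ∑' t, colH (KInv (N := Lc)) Lc κ' u κ t * ctGen d α Lc κ t p c)))) (KInv (N := Lc)))) := by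
  rw [e3NAtOf_one, e3NAtOf_one]
  exact neg_mmRead_sandwich_vertexOf_S0NAt_bref hLc cΛ hn spr_KInv (refK_KInv α) κ' u

/-- [folklore] **THE SAME LAW ON FIELD–FIELD ENTRIES, in the spelling of the socket `hE3ff`** of
`SpineRooted.SstepNAt_bref_of_e3Law`: the contact slot holds `𝒞 α κ′ u` read at the reflected sites. -/
theorem e3NAtOf_one_bref_inl_inl (hLc : Odd Lc) {cE cVH : ℝ} (cΛ : ℝ) (hn : 2 * cVH = -(cE * (Lc : ℝ) ^ (d + 1)))
    (α κ' : Fin (d + 1)) (u x z : Fin (d + 1) → ℤ) (a b : Fin (d + 1)) :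
    e3NAtOf d Lc (ctr (d + 1) Lc) cE cVH cΛ 1 κ' (bref α κ' u) x z (Sum.inl a) (Sum.inl b) =
      reflSign α κ' * ((Φ (d := d) Lc α).s (Sum.inl a) * (Φ (d := d) Lc α).s (Sum.inl b) *
        (e3NAtOf d Lc (ctr (d + 1) Lc) cE cVH cΛ 1 κ' u ((Φ (d := d) Lc α).r (Sum.inl a) x) ((Φ (d := d) Lc α).r (Sum.inl b) z)
            (Sum.inl a) (Sum.inl b) +
          (-mmRead Lc (comp (comp (KInv (N := Lc)) (conjV (bhKAt d (ctr (d + 1) Lc) Lc) ((cVH / (Lc : ℝ) ^ (d + 1)) •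
            diagK (fun p c => ∑ κ, ∑' t, colH (KInv (N := Lc)) Lc κ' u κ t * ctGen d α Lc κ t p c)))) (KInv (N := Lc))))
            ((Φ (d := d) Lc α).r (Sum.inl a) x) ((Φ (d := d) Lc α).r (Sum.inl b) z) (Sum.inl a) (Sum.inl b))) := by
  rw [e3NAtOf_one_bref hLc cΛ hn α κ' u]
  simp only [Pi.smul_apply, smul_eq_mul, refK_apply, Pi.add_apply]

/-- [folklore] **THE SOCKET IS A CONTACT EVALUATION.**  For any candidate kernel `C′`, the `hE3ff`-shaped law with `C′` in the
contact slot holds at `(α, κ′, u)` on all field–field entries IFF the level-1 contact `𝒞 α κ′ u` and `C′` have the same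
field–field block (the leg maps are bijections and the signs are units). -/
theorem e3Law_ff_iff (hLc : Odd Lc) {cE cVH : ℝ} (cΛ : ℝ) (hn : 2 * cVH = -(cE * (Lc : ℝ) ^ (d + 1)))
    (α κ' : Fin (d + 1)) (u : Fin (d + 1) → ℤ) (C' : MKer (d + 1) (Fib d)) :
    (∀ (x z : Fin (d + 1) → ℤ) (a b : Fin (d + 1)),
      e3NAtOf d Lc (ctr (d + 1) Lc) cE cVH cΛ 1 κ' (bref α κ' u) x z (Sum.inl a) (Sum.inl b) =
        reflSign α κ' * ((Φ (d := d) Lc α).s (Sum.inl a) * (Φ (d := d) Lc α).s (Sum.inl b) *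
          (e3NAtOf d Lc (ctr (d + 1) Lc) cE cVH cΛ 1 κ' u ((Φ (d := d) Lc α).r (Sum.inl a) x) ((Φ (d := d) Lc α).r (Sum.inl b) z)
              (Sum.inl a) (Sum.inl b) +
            C' ((Φ (d := d) Lc α).r (Sum.inl a) x) ((Φ (d := d) Lc α).r (Sum.inl b) z) (Sum.inl a) (Sum.inl b)))) ↔
    (∀ (x z : Fin (d + 1) → ℤ) (a b : Fin (d + 1)),
      (-mmRead Lc (comp (comp (KInv (N := Lc)) (conjV (bhKAt d (ctr (d + 1) Lc) Lc) ((cVH / (Lc : ℝ) ^ (d + 1)) •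
        diagK (fun p c => ∑ κ, ∑' t, colH (KInv (N := Lc)) Lc κ' u κ t * ctGen d α Lc κ t p c)))) (KInv (N := Lc))))
        x z (Sum.inl a) (Sum.inl b) = C' x z (Sum.inl a) (Sum.inl b)) := by
  have hε : reflSign α κ' ≠ 0 := fun h => by simpa [h] using reflSign_mul_self α κ'
  have hs : ∀ c : Fib d, (Φ (d := d) Lc α).s c ≠ 0 := fun c h => by simpa [h] using (Φ (d := d) Lc α).s_mul_s c
  constructor
  · intro h x z a b
    have h1 := h ((Φ (d := d) Lc α).r (Sum.inl a) x) ((Φ (d := d) Lc α).r (Sum.inl b) z) a b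
    rw [e3NAtOf_one_bref_inl_inl hLc cΛ hn, Φ_r_r, Φ_r_r] at h1
    have h2 := mul_left_cancel₀ hε h1
    have h3 := mul_left_cancel₀ (mul_ne_zero (hs _) (hs _)) h2
    exact add_left_cancel h3
  · intro h x z a b
    rw [e3NAtOf_one_bref_inl_inl hLc cΛ hn, h]

/-- [folklore] **`hE3ff` AT LEVEL 1 IS THE DIAGONAL-CONTACT IDENTITY FOR `𝒞`.**  The level-`1` instance of the socket `hE3ff` of
`SpineRooted.SstepNAt_bref_of_e3Law` (contact slot `c · conjV 𝕄 (diagK (ctGen d α Lc κ′ u))`, for whatever `c`, `𝕄` the caller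
chooses) holds IFF the field–field block of the level-1 contact `𝒞 α κ′ u` equals `c · (conjV 𝕄 (diagK (ctGen d α Lc κ′ u)))_ff`
for all `(α, κ′, u)`.  (This module does not assert either side; an exact-rational toy indicates the right side fails for the raw
straight resolvent at `d = 1`, `Lc = 3` — journal RESULT l.6419 / REFEREE #2 l.6621.) -/
theorem e3Law_one_iff_contact (hLc : Odd Lc) {cE cVH : ℝ} (cΛ : ℝ) (hn : 2 * cVH = -(cE * (Lc : ℝ) ^ (d + 1))) (c : ℝ)
    (𝕄 : MKer (d + 1) (Fib d)) :
    (∀ (α κ' : Fin (d + 1)) (u x z : Fin (d + 1) → ℤ) (a b : Fin (d + 1)),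
      e3NAtOf d Lc (ctr (d + 1) Lc) cE cVH cΛ 1 κ' (bref α κ' u) x z (Sum.inl a) (Sum.inl b) =
        reflSign α κ' * ((Φ (d := d) Lc α).s (Sum.inl a) * (Φ (d := d) Lc α).s (Sum.inl b) *
          (e3NAtOf d Lc (ctr (d + 1) Lc) cE cVH cΛ 1 κ' u ((Φ (d := d) Lc α).r (Sum.inl a) x) ((Φ (d := d) Lc α).r (Sum.inl b) z)
              (Sum.inl a) (Sum.inl b) +
            c * conjV 𝕄 (diagK (ctGen d α Lc κ' u)) ((Φ (d := d) Lc α).r (Sum.inl a) x) ((Φ (d := d) Lc α).r (Sum.inl b) z)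
              (Sum.inl a) (Sum.inl b)))) ↔
    (∀ (α κ' : Fin (d + 1)) (u x z : Fin (d + 1) → ℤ) (a b : Fin (d + 1)),
      (-mmRead Lc (comp (comp (KInv (N := Lc)) (conjV (bhKAt d (ctr (d + 1) Lc) Lc) ((cVH / (Lc : ℝ) ^ (d + 1)) •
        diagK (fun p c => ∑ κ, ∑' t, colH (KInv (N := Lc)) Lc κ' u κ t * ctGen d α Lc κ t p c)))) (KInv (N := Lc))))
        x z (Sum.inl a) (Sum.inl b) = c * conjV 𝕄 (diagK (ctGen d α Lc κ' u)) x z (Sum.inl a) (Sum.inl b)) := by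
  refine forall_congr' fun α => forall_congr' fun κ' => forall_congr' fun u => ?_
  exact e3Law_ff_iff hLc cΛ hn α κ' u (fun x z a b => c * conjV 𝕄 (diagK (ctGen d α Lc κ' u)) x z a b)

end Instance

end Summit.QuantumFields.BalabanUV.Beta.E3LevelOneReflection

end
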